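/-
Copyright (c) 2026. All rights reserved.
Released under Apache 2.0 license as described in the file LICENSE.
Authors: abc-iut cell, seat abc-iut-w5-d218 (gen 3).
-/
import Mathlib.GroupTheory.Index
import Mathlib.Topology.Algebra.ClopenNhdofOne
import Mathlib.Topology.Algebra.OpenSubgroup
import Mathlib.Topology.Algebra.Group.Quotient

/-!
# Strong completeness is closed under extensions (profinite groups)

A profinite group is *strongly complete* when every subgroup of finite index is open (equivalently every
homomorphism to a finite group is continuous; Nikolov–Segal prove this for all topologically finitely
generated profinite groups, Serre for topologically finitely generated pro-`p` groups —
`Literature/GroupTheory/ProPStronglyComplete.lean`).  This file records the elementary dévissage step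
(folklore; cf. L. Ribes, P. Zalesskii, *Profinite Groups*, §4.2): if `C ⊴ G` is a normal subgroup of a
profinite group `G` such that every finite-index subgroup of `C` is open in `C` and every finite-index
subgroup of `G ⧸ C` is open in `G ⧸ C` (quotient topology), then every finite-index subgroup of `G` is
open.  Proof: for `H ≤ G` of finite index, `H ∩ C` is open in `C`, so some open normal subgroup `V` of
`G` has `V ∩ C ⊆ H`; the image of `H ∩ V` in `G ⧸ C` has finite index, hence is open, and its preimage
`P = (H ∩ V)·C` satisfies `P ∩ V ⊆ H`; so `H` contains a neighbourhood of `1`.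

No definition is introduced ("strongly complete" is spelled out).  Intended use (abc-iut): reduce strong
completeness of an absolute Galois group of a `p`-adic field to its wild inertia subgroup and tame
quotient; only the abstract step is proved here.

[cite: DDMSAnalyticProP1999, §1.3]
-/

namespace Literature.GroupTheory

variable {G : Type*} [Group G] [TopologicalSpace G] [IsTopologicalGroup G] [CompactSpace G]
  [TotallyDisconnectedSpace G]

/-- **Extensions of strongly complete profinite groups are strongly complete.** Let `C` be a normal
subgroup of a profinite group `G`.  If every finite-index subgroup of `C` is open in `C` (subspace
topology) and every finite-index subgroup of `G ⧸ C` is open (quotient topology), then every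
finite-index subgroup of `G` is open. [cite: DDMSAnalyticProP1999, §1.3] -/
theorem isOpen_of_finiteIndex_of_extension (C : Subgroup G) [C.Normal]
    (hC : ∀ V : Subgroup C, V.FiniteIndex → IsOpen (V : Set C))
    (hQ : ∀ W : Subgroup (G ⧸ C), W.FiniteIndex → IsOpen (W : Set (G ⧸ C)))
    (H : Subgroup G) [H.FiniteIndex] : IsOpen (H : Set G) := by
  -- `H ∩ C` is open in `C`: it is the trace of an open set `O ∋ 1` of `G`
  have hHC : IsOpen ((H.subgroupOf C : Subgroup C) : Set C) := hC _ inferInstance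
  obtain ⟨O, hO, hOC⟩ := isOpen_induced_iff.mp hHC
  have h1O : (1 : G) ∈ O := by
    have : (1 : C) ∈ Subtype.val ⁻¹' O := by rw [hOC]; exact (H.subgroupOf C).one_mem
    exact this
  -- an open normal subgroup `V ⊆ O`; then `V ∩ C ⊆ H`
  obtain ⟨V, hV⟩ := ProfiniteGrp.exist_openNormalSubgroup_sub_open_nhds_of_one hO h1O
  have hVC : ∀ x : G, x ∈ (V : Set G) → x ∈ C → x ∈ H := by
    intro x hxV hxC
    have hx : (⟨x, hxC⟩ : C) ∈ Subtype.val ⁻¹' O := hV hxV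
    rw [hOC] at hx
    exact Subgroup.mem_subgroupOf.mp hx
  -- `H₂ = H ∩ V` has finite index; its image `W` in `G ⧸ C` has finite index, hence is open
  haveI : Finite (G ⧸ (V : Subgroup G)) := Subgroup.quotient_finite_of_isOpen _ V.isOpen
  haveI : (V : Subgroup G).FiniteIndex := Subgroup.finiteIndex_of_finite_quotient
  set H₂ : Subgroup G := H ⊓ (V : Subgroup G) with hH₂
  set W : Subgroup (G ⧸ C) := H₂.map (QuotientGroup.mk' C) with hW
  haveI : W.FiniteIndex := by
    refine ⟨fun h0 => ?_⟩
    have hdvd := Subgroup.index_map_dvd H₂ (QuotientGroup.mk'_surjective C)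
    rw [h0, zero_dvd_iff] at hdvd
    exact Subgroup.FiniteIndex.index_ne_zero hdvd
  have hWopen : IsOpen ((W : Subgroup (G ⧸ C)) : Set (G ⧸ C)) := hQ W inferInstance
  -- its preimage `P` is open and `P ∩ V ⊆ H`
  have hPopen : IsOpen ((QuotientGroup.mk : G → G ⧸ C) ⁻¹' (W : Set (G ⧸ C))) :=
    hWopen.preimage QuotientGroup.continuous_mk
  have hsub : (QuotientGroup.mk : G → G ⧸ C) ⁻¹' (W : Set (G ⧸ C)) ∩ (V : Set G) ⊆ (H : Set G) := by
    rintro x ⟨hxP, hxV⟩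
    obtain ⟨h, hh, hhx⟩ := Subgroup.mem_map.mp hxP
    have hc : h⁻¹ * x ∈ C := QuotientGroup.eq.mp hhx
    have hhV : h ∈ (V : Subgroup G) := (inf_le_right : H₂ ≤ (V : Subgroup G)) hh
    have hcV : h⁻¹ * x ∈ (V : Set G) := mul_mem (inv_mem hhV) hxV
    have hcH : h⁻¹ * x ∈ H := hVC _ hcV hc
    have hhH : h ∈ H := (inf_le_left : H₂ ≤ H) hh
    simpa using mul_mem hhH hcH
  refine Subgroup.isOpen_of_mem_nhds H (g := 1) ?_
  exact Filter.mem_of_superset ((hPopen.inter V.isOpen).mem_nhds ⟨by simp [W.one_mem], V.one_mem⟩)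
    hsub

end Literature.GroupTheory
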